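import Literature.Topology.PlanarFoliations.NullTransport
import Literature.Topology.PlanarFoliations.LoopConjugation
import HarnessLib

/-!
# The set of compact leaves with null-homotopic image is open

Topic: Topology / PlanarFoliations. Let `F : Foliation ℝ X` be a bi-oriented, transversely
oriented planar foliation and `f` a foliated map from `(X, F)` to a `C⁰` codimension-one
foliation `T` (`TautFoliationsFoliatedMaps.lean`). A point `y` has **image-null compact
leaf** (`ImageNull`) if its leaf is parametrised by an injective leaf loop `γ` (so the leaf
is compact, `ImageNull.isCompact_leaf`) whose image loop `f ∘ γ` is null-homotopic in the
leaf topology of `T`. The main theorem of this file is that **the set of such points is open**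
(`isOpen_setOf_imageNull`) — the openness of the regions `Vᵢ` (maximal connected unions of
closed orbits homotopic to constants in their leaves) in the proof of the existence of
vanishing cycles, Camacho–Lins Neto, *Geometric Theory of Foliations*, Ch. VII §2 Prop. 1.

The proof assembles the bricks of the preceding files exactly as in the printed argument:
the image loop being null-homotopic, the holonomy of `γ` is trivial (naturality of holonomy,
`IsFoliatedMap.holonomyGerm_eq_id_of_map_homotopic_refl`), so the fence with matched ends
over `γ` closes up (`exists_closedFence`, "Theorem 3 of Chapter IV"); its horizontals `h_τ`
are leaf loops at the points `V τ` of the vertical through `γ 0`, the leaves `L_τ` through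
these points are compact (`ClosedFence.exists_forall_isCompact_leaf`), the image loops
`f ∘ h_τ` are null-homotopic in their leaves (`ClosedFence.exists_forall_homotopic_refl_map`,
"Lemma 4 of Chapter IV"), and `h_τ` is homotopic in `L_τ` to an injective loop of `L_τ`
(`CircleLoops.homotopic_loop_or_revLoop`, the degree-one criterion fed by
`ClosedFence.exists_constants`); finally every point near a point of the leaf of `γ` lies on
one of the `L_τ` (the fence levels correctly in a local datum around that point).

* `ImageNull` (**definition**), `ImageNull.of_leaf_eq`, `ImageNull.isCompact_leaf` (**proved**).
* `exists_rebase`, `rev_loop` (**proved**): re-basing and reversing injective loops.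
* `ImageNull.map_loop` (**proved**): for an image-null leaf, the image of *every* injective leaf
  loop of the leaf is null-homotopic (`LoopConjugation.lean`).
* `imageNull_vert` (**proved**): the leaves of the band are image-null.
* `isOpen_setOf_imageNull` (**proved**): the theorem.

## References

* C. Camacho, A. Lins Neto, *Geometric Theory of Foliations*, Birkhäuser (1985), Ch. VII §2
  Prop. 1, Ch. IV §2 Thm. 3, Lemma 4 [CamachoLinsNeto1985].
-/

noncomputable section

open Set Filter Function
open _root_.Topology unitInterval
open Literature.Topology.FourManifolds Literature.Topology.FourManifolds.Foliation

namespace Literature.Topology.PlanarFoliations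

variable {X : Type*} [TopologicalSpace X] {F : Foliation ℝ X}
variable {B : Type*} [NormedAddCommGroup B] {M : Type*} [TopologicalSpace M] {T : Foliation B M} {f : X → M}

/-! ## Re-basing injective loops -/

/-- **Re-basing an injective loop**: an injective loop onto `Y` can be re-based at any point
`p` of `Y` (translate the parameter). [folklore] -/
theorem exists_rebase {Y : Type*} [TopologicalSpace Y] {β : ℝ → Y} (hc : Continuous β)
    (hp : Periodic β 1) (hinj : InjOn β (Ico 0 1)) (hsurj : range β = univ) (p : Y) :
    ∃ β' : ℝ → Y, Continuous β' ∧ Periodic β' 1 ∧ InjOn β' (Ico 0 1) ∧ range β' = univ ∧ β' 0 = p := by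
  obtain ⟨s₀, hs₀⟩ : p ∈ range β := by rw [hsurj]; exact mem_univ p
  refine ⟨fun s ↦ β (s + s₀), hc.comp (continuous_id.add continuous_const), fun s ↦ ?_, ?_, ?_, ?_⟩
  · show β (s + 1 + s₀) = β (s + s₀)
    rw [show s + 1 + s₀ = (s + s₀) + 1 by ring]
    exact hp _
  · intro s hs t ht hst
    have h := CircleLoops.injOn_Ico_of_periodic hp hinj s₀ ⟨by linarith [hs.1], by linarith [hs.2]⟩
      ⟨by linarith [ht.1], by linarith [ht.2]⟩ hst
    linarith
  · refine eq_univ_of_forall fun y ↦ ?_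
    obtain ⟨u, rfl⟩ : y ∈ range β := by rw [hsurj]; exact mem_univ y
    exact ⟨u - s₀, by simp⟩
  · simpa using hs₀

/-- The reverse of an injective loop onto `Y` is an injective loop onto `Y`. [folklore] -/
theorem rev_loop {Y : Type*} [TopologicalSpace Y] {β : ℝ → Y} (hc : Continuous β)
    (hp : Periodic β 1) (hinj : InjOn β (Ico 0 1)) (hsurj : range β = univ) :
    Continuous (fun s ↦ β (-s)) ∧ Periodic (fun s ↦ β (-s)) 1 ∧ InjOn (fun s ↦ β (-s)) (Ico 0 1) ∧
      range (fun s ↦ β (-s)) = univ := by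
  refine ⟨hc.comp continuous_neg, fun s ↦ ?_, ?_, ?_⟩
  · show β (-(s + 1)) = β (-s)
    have h := hp (-(s + 1))
    rw [show -(s + 1) + 1 = -s by ring] at h
    exact h.symm
  · intro s hs t ht hst
    have key : ∀ u ∈ Ico (0 : ℝ) 1, ∀ v ∈ Ico (0 : ℝ) 1, β (-u) = β (-v) → u = v := by
      intro u hu v hv huv
      have hu' : 1 - u ∈ Ioc (0 : ℝ) 1 := ⟨by linarith [hu.2], by linarith [hu.1]⟩
      have hv' : 1 - v ∈ Ioc (0 : ℝ) 1 := ⟨by linarith [hv.2], by linarith [hv.1]⟩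
      have e₁ : β (-u) = β (1 - u) := by rw [show (1 : ℝ) - u = -u + 1 by ring]; exact (hp _).symm
      have e₂ : β (-v) = β (1 - v) := by rw [show (1 : ℝ) - v = -v + 1 by ring]; exact (hp _).symm
      rw [e₁, e₂] at huv
      -- both `1 - u`, `1 - v` in `(0, 1]`; map `1 ↦ 0` by periodicity and use injectivity on `[0, 1)`
      have hfr : ∀ w ∈ Ioc (0 : ℝ) 1, β (Int.fract w) = β w ∧ Int.fract w ∈ Ico (0 : ℝ) 1 := fun w _ ↦
        ⟨CircleLoops.apply_fract hp w, Int.fract_nonneg w, Int.fract_lt_one w⟩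
      have h₁ := hfr _ hu'
      have h₂ := hfr _ hv'
      rw [← h₁.1, ← h₂.1] at huv
      have heq := hinj h₁.2 h₂.2 huv
      rw [Int.fract_eq_fract] at heq
      obtain ⟨k, hk⟩ := heq
      have hlt : |(1 - u) - (1 - v)| < 1 := by
        rw [abs_lt]; constructor <;> linarith [hu.1, hu.2, hv.1, hv.2]
      rw [hk] at hlt
      have hk0 : k = 0 := by
        have h' : |(k : ℝ)| < 1 := hlt
        rw [← Int.cast_abs] at h'
        have h'' : |k| < 1 := by exact_mod_cast h'
        exact Int.abs_lt_one_iff.1 h''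
      have : (1 - u) - (1 - v) = 0 := by rw [hk, hk0]; simp
      linarith
    exact key s hs t ht hst
  · refine eq_univ_of_forall fun y ↦ ?_
    obtain ⟨u, rfl⟩ : y ∈ range β := by rw [hsurj]; exact mem_univ y
    exact ⟨-u, by simp⟩

/-! ## Image-null compact leaves -/

/-- The point `y` has **image-null compact leaf** (for the foliated map `f` from the planar
foliation `F` to `T`): its leaf is that of a point `x` and is parametrised by an injective
leaf loop `γ` — continuous in the leaf topology, `1`-periodic, injective on `[0, 1)`, onto —
whose image loop `f ∘ γ` is null-homotopic in the leaf topology of `T` ("a closed orbit whose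
image is homotopic to a constant in its leaf", Camacho–Lins Neto, Ch. VII §2).
[cite: CamachoLinsNeto1985, Ch. VII §2 Prop. 1] -/
def ImageNull (hf : IsFoliatedMap F T f) (y : X) : Prop :=
  ∃ (x : X) (γ : ℝ → F.Leaf x) (hc : Continuous γ) (hp : Periodic γ 1), y ∈ F.leaf x ∧
    InjOn γ (Ico 0 1) ∧ range γ = univ ∧
    ((F.leafLoop (loopPath γ hc hp) (continuous_toLeafSpace_loopPath γ hc hp)).map
      hf.continuous_leafMap).Homotopic (Path.refl _)

namespace ImageNull

variable {hf : IsFoliatedMap F T f} {y y' : X}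

/-- `ImageNull` is a property of the leaf. [folklore] -/
theorem of_mem_leaf (h : ImageNull hf y) (hy' : y' ∈ F.leaf y) : ImageNull hf y' := by
  obtain ⟨x, γ, hc, hp, hyx, hinj, hsurj, hnull⟩ := h
  refine ⟨x, γ, hc, hp, ?_, hinj, hsurj, hnull⟩
  rw [← F.leaf_eq_of_mem hyx]
  exact hy'

/-- An image-null leaf is compact. [folklore] -/
theorem isCompact_leaf [T2Space X] (h : ImageNull hf y) : IsCompact (F.leaf y) := by
  obtain ⟨x, γ, hc, hp, hyx, -, hsurj, -⟩ := h
  rw [F.leaf_eq_of_mem hyx, leaf_eq_range_coe]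
  have hK : IsCompact (range γ) := by
    have h : range γ = γ '' Icc 0 1 := by
      refine Subset.antisymm ?_ (image_subset_range _ _)
      rintro _ ⟨s, rfl⟩
      exact ⟨Int.fract s, ⟨Int.fract_nonneg s, (Int.fract_lt_one s).le⟩, CircleLoops.apply_fract hp s⟩
    rw [h]
    exact isCompact_Icc.image hc
  rw [hsurj] at hK
  have := hK.image (Leaf.continuous_coe F x)
  rwa [image_univ] at this

/-- **For an image-null leaf, the image of every injective leaf loop of the leaf is
null-homotopic** (null-homotopy of the image does not depend on the injective loop,
`CircleLoops.map_loop_homotopic_refl_of_map_loop`, read in a leaf arc). [folklore] -/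
theorem map_loop [T2Space X] (h : ImageNull hf y) {y' : X} (β' : ℝ → F.Leaf y') (hc' : Continuous β')
    (hp' : Periodic β' 1) (hinj' : InjOn β' (Ico 0 1)) (hy : y ∈ F.leaf y') :
    ((F.leafLoop (loopPath β' hc' hp') (continuous_toLeafSpace_loopPath β' hc' hp')).map
      hf.continuous_leafMap).Homotopic (Path.refl _) := by
  obtain ⟨x, γ, hc, hp, hyx, hinj, hsurj, hnull⟩ := h
  have hleaf : F.leaf y' = F.leaf x := (F.leaf_eq_of_mem hy).symm.trans (F.leaf_eq_of_mem hyx)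
  -- the loop `β'` as a loop of the leaf of `x`
  set β'' : ℝ → F.Leaf x := fun s ↦ ⟨((β' s : F.Leaf y') : F.LeafSpace), by
    show ofLeafSpace ((β' s : F.Leaf y') : F.LeafSpace) ∈ F.leaf x
    rw [← hleaf]
    exact (β' s).2⟩ with hβ''
  have hc'' : Continuous β'' := (continuous_subtype_val.comp hc').subtype_mk _
  have hp'' : Periodic β'' 1 := fun s ↦ Subtype.ext (congrArg (fun q : F.Leaf y' ↦ (q : F.LeafSpace)) (hp' s))
  have hinj'' : InjOn β'' (Ico 0 1) := fun s hs t ht hst ↦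
    hinj' hs ht (Subtype.ext (congrArg (fun q : F.Leaf x ↦ (q : F.LeafSpace)) hst))
  -- a leaf arc at `β'' 0`
  obtain ⟨e, he, h0e⟩ := F.exists_mem_source (ofLeafSpace ((β'' 0 : F.Leaf x) : F.LeafSpace))
  have hP : plaque e (e (ofLeafSpace ((β'' 0 : F.Leaf x) : F.LeafSpace))).2 ⊆ F.leaf x :=
    F.plaque_subset_leaf_of_mem he (β'' 0).2 (mem_plaque_self h0e)
  have h0 : β'' 0 ∈ (leafArc e _ hP he).source := (mem_leafArc_source_iff hP he).2 (mem_plaque_self h0e)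
  -- the map into the leaf space of `T`
  set Φf : C(F.Leaf x, T.LeafSpace) :=
    ⟨fun q ↦ leafMap F T f (q : F.LeafSpace), hf.continuous_leafMap.comp continuous_subtype_val⟩ with hΦf
  have hnull' : ((CircleLoops.loop hc hp).map Φf.continuous).Homotopic (Path.refl _) := by
    have heq : (CircleLoops.loop hc hp).map Φf.continuous =
        (F.leafLoop (loopPath γ hc hp) (continuous_toLeafSpace_loopPath γ hc hp)).map hf.continuous_leafMap := by
      ext θ
      rfl
    rw [heq]
    exact hnull
  have key := CircleLoops.map_loop_homotopic_refl_of_map_loop hc hp hinj hsurj hc'' hp'' hinj''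
    (leafArc_target hP he) h0 Φf hnull'
  have heq : (F.leafLoop (loopPath β' hc' hp') (continuous_toLeafSpace_loopPath β' hc' hp')).map
      hf.continuous_leafMap = (CircleLoops.loop hc'' hp'').map Φf.continuous := by
    ext θ
    rfl
  rw [heq]
  exact key

end ImageNull

/-! ## The leaves of the band are image-null -/

section Band

variable [T2Space X] [SecondCountableTopology X] (hbi : IsBiOriented F) (hf : IsFoliatedMap F T f)
variable {x : X} {γ : ℝ → F.Leaf x} {e₀ : OpenPartialHomeomorph X (ℝ × ℝ)}

/-- The horizontal loop of level `τ` of a closed fence, as a loop of the leaf of `V τ` in its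
leaf topology. [folklore] -/
def ClosedFence.horizLeafPath (C : ClosedFence γ e₀) {τ : ℝ}
    (hτ : τ ∈ Ioo (baseLevel γ e₀ - C.ε) (baseLevel γ e₀ + C.ε)) :
    Path (Leaf.mk (vert γ e₀ τ) (F.mem_leaf_self _) : F.Leaf (vert γ e₀ τ))
      (Leaf.mk (vert γ e₀ τ) (F.mem_leaf_self _)) where
  toFun θ := ⟨toLeafSpace (C.Φ θ τ), C.Φ_mem_leaf hτ θ⟩
  continuous_toFun := (C.continuous_toLeafSpace_Φ hτ).subtype_mk _
  source' := Subtype.ext (congrArg toLeafSpace (C.Φ_zero hτ))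
  target' := Subtype.ext (congrArg toLeafSpace (C.Φ_one hτ))

include hbi in
/-- **The leaves of the band of a closed fence with image-null base leaf are image-null.**
For a closed fence `C` over the injective leaf loop `γ` whose image loop is null-homotopic,
and a level `τ` in the range of the constants of `C` (`exists_constants`), of the stability
theorem and of the transport theorem, the leaf of `V τ` is image-null: it is compact, its
injective loop re-based at `V τ` (or the reverse) is homotopic in the leaf to the horizontal
`h_τ` by the degree-one criterion, and `f ∘ h_τ` is null-homotopic. [folklore] -/
theorem imageNull_vert (C : ClosedFence γ e₀) {τ : ℝ}
    (hτ : τ ∈ Ioo (baseLevel γ e₀ - C.ε) (baseLevel γ e₀ + C.ε))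
    (hK : IsCompact (F.leaf (vert γ e₀ τ)))
    (hnull : ((C.horizPath τ).map hf.continuous_leafMap).Homotopic (Path.refl _))
    {θ₁ : I} (hθ₀ : 0 < (θ₁ : ℝ)) (hθhalf : (θ₁ : ℝ) < 1 / 2)
    (ha : ∀ θ : I, (θ : ℝ) ≤ θ₁ ∨ 1 - θ₁ ≤ (θ : ℝ) → C.Φ θ τ ∈ plaque e₀ τ)
    (hb : ∀ θ : I, (θ₁ : ℝ) ≤ θ → (θ : ℝ) ≤ 1 - θ₁ → C.Φ θ τ ≠ vert γ e₀ τ)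
    (hside : ((e₀ (C.Φ θ₁ τ)).1 - baseCoord γ e₀) * ((e₀ (C.Φ (σ θ₁) τ)).1 - baseCoord γ e₀) < 0) :
    ImageNull hf (vert γ e₀ τ) := by
  have he₀ := C.box_mem
  set y : X := vert γ e₀ τ with hy
  haveI : CompactSpace (F.Leaf y) := compactSpace_leaf_of_isCompact hK
  -- an injective loop of the leaf, re-based at `V τ`
  set p : F.Leaf y := Leaf.mk y (F.mem_leaf_self y) with hpdef
  obtain ⟨β₀, hβ₀c, hβ₀p, hβ₀i, hβ₀s⟩ := exists_leafLoop (x := y) hbi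
  obtain ⟨β, hβc, hβp, hβi, hβs, hβ0⟩ := exists_rebase hβ₀c hβ₀p hβ₀i hβ₀s p
  -- the horizontal loop in the leaf, cast to a loop at `β 0`
  set h : Path (β 0) (β 0) := (C.horizLeafPath hτ).cast hβ0 hβ0 with hh
  have hhap : ∀ θ, h θ = ⟨toLeafSpace (C.Φ θ τ), C.Φ_mem_leaf hτ θ⟩ := fun θ ↦ rfl
  -- the arc chart of the plaque through `V τ`
  have hyp : y ∈ plaque e₀ τ := vert_mem_plaque he₀ τ
  have hP : plaque e₀ τ ⊆ F.leaf y := F.plaque_subset_leaf_of_mem he₀ (F.mem_leaf_self y) hyp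
  set c := leafArc e₀ τ hP he₀ with hc
  have hcp : c (β 0) = baseCoord γ e₀ := by
    rw [hβ0, leafArc_apply hP he₀ ((mem_leafArc_source_iff hP he₀ (p := p)).2 hyp)]
    show (e₀ (vert γ e₀ τ)).1 = baseCoord γ e₀
    rw [apply_vert he₀]
  have hch : ∀ θ : I, C.Φ θ τ ∈ plaque e₀ τ → h θ ∈ c.source ∧ c (h θ) = (e₀ (C.Φ θ τ)).1 := by
    intro θ hθ
    have hsrc : h θ ∈ c.source := by
      rw [hhap]
      exact (mem_leafArc_source_iff hP he₀).2 hθ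
    exact ⟨hsrc, by rw [leafArc_apply hP he₀ hsrc]; rfl⟩
  -- the degree-one criterion
  have hcrit := CircleLoops.homotopic_loop_or_revLoop hβc hβp hβi hβs (c := c) (leafArc_target hP he₀) h
    hθ₀ hθhalf (fun θ hθ ↦ (hch θ (ha θ hθ)).1)
    (fun θ h₁ h₂ heq ↦ hb θ h₁ h₂ (by
      have h' : h θ = p := heq.trans hβ0
      rw [hhap] at h'
      exact congrArg (fun q : F.Leaf y ↦ ofLeafSpace (q : F.LeafSpace)) h'))
    (by
      rw [(hch θ₁ (ha θ₁ (Or.inl le_rfl))).2, (hch (σ θ₁) (ha (σ θ₁) (Or.inr (by rw [coe_symm_eq])))).2, hcp]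
      exact hside)
  -- push the homotopies to the leaf space of `T`
  set Φf : C(F.Leaf y, T.LeafSpace) :=
    ⟨fun q ↦ leafMap F T f (q : F.LeafSpace), hf.continuous_leafMap.comp continuous_subtype_val⟩ with hΦf
  have e : leafMap F T f (toLeafSpace (vert γ e₀ τ)) = Φf (β 0) := by rw [hβ0]; rfl
  have hhT : ((C.horizPath τ).map hf.continuous_leafMap) = (h.map Φf.continuous).cast e e := by
    ext θ
    rw [Path.cast_coe, Path.map_coe, Path.map_coe, comp_apply, comp_apply, C.horizPath_apply hτ, hhap]
    rfl
  have hrefl : (Path.refl (Φf (β 0))).cast e e = Path.refl _ := by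
    ext θ
    exact e.symm
  have hnull' : (h.map Φf.continuous).Homotopic (Path.refl _) := by
    refine CircleLoops.homotopic_of_cast e e ?_
    rw [← hhT, hrefl]
    exact hnull
  rcases hcrit with hom | hom
  · -- `h ≃ β`
    refine ⟨y, β, hβc, hβp, F.mem_leaf_self y |> fun h' ↦ ?_, hβi, hβs, ?_⟩
    · show y ∈ F.leaf y
      exact F.mem_leaf_self y
    · have hA : ((CircleLoops.loop hβc hβp).map Φf.continuous).Homotopic (h.map Φf.continuous) :=
        (hom.map Φf).symm
      have heq : (F.leafLoop (loopPath β hβc hβp) (continuous_toLeafSpace_loopPath β hβc hβp)).map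
          hf.continuous_leafMap = (CircleLoops.loop hβc hβp).map Φf.continuous := by
        ext θ
        rfl
      rw [heq]
      exact hA.trans hnull'
  · -- `h ≃ β(-·)`
    obtain ⟨hβ'c, hβ'p, hβ'i, hβ's⟩ := rev_loop hβc hβp hβi hβs
    refine ⟨y, fun s ↦ β (-s), hβ'c, hβ'p, F.mem_leaf_self y, hβ'i, hβ's, ?_⟩
    have hA : ((CircleLoops.revLoop hβc hβp).map Φf.continuous).Homotopic (h.map Φf.continuous) :=
      (hom.map Φf).symm
    have e' : Φf (β (-0)) = Φf (β 0) := by rw [neg_zero]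
    have heq : ((F.leafLoop (loopPath (fun s ↦ β (-s)) hβ'c hβ'p)
        (continuous_toLeafSpace_loopPath (fun s ↦ β (-s)) hβ'c hβ'p)).map hf.continuous_leafMap) =
          ((CircleLoops.revLoop hβc hβp).map Φf.continuous).cast e' e' := by
      ext θ
      rfl
    rw [heq]
    have hrefl : (Path.refl (Φf (β (-0)))) = (Path.refl (Φf (β 0))).cast e' e' := by
      ext θ
      exact e'
    rw [show (Path.refl (leafMap F T f (toLeafSpace (loopBase fun s ↦ β (-s))))) =
      (Path.refl (Φf (β 0))).cast e' e' from hrefl]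
    exact CircleLoops.homotopic_cast e' e' (hA.trans hnull')

/-! ## The openness theorem -/

include hbi in
/-- **The set of points with image-null compact leaf is open** — the openness of the regions
`Vᵢ` in Camacho–Lins Neto, Ch. VII §2, Prop. 1 (see the module docstring for the chain of
bricks). [cite: CamachoLinsNeto1985, Ch. VII §2 Prop. 1] -/
theorem isOpen_setOf_imageNull [NormedSpace ℝ B] [LocallyConnectedSpace B] (ho : F.IsTransverselyOriented) :
    IsOpen {y | ImageNull hf y} := by
  refine isOpen_iff_mem_nhds.2 fun y₀ hy₀ ↦ ?_
  obtain ⟨x, γ, hc, hp, hy₀x, hinj, hsurj, hnull⟩ := hy₀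
  -- the closed fence over `γ`: trivial holonomy by naturality
  obtain ⟨c₀, hc₀, hx₀⟩ := F.exists_mem_source (loopBase γ)
  obtain ⟨ê₀, hê₀, hfx₀⟩ := T.exists_mem_source (f (loopBase γ))
  obtain ⟨ι, hι, hcomp⟩ := hf.exists_compat hc₀ hx₀ hê₀ hfx₀
  have hhol := hf.holonomyGerm_eq_id_of_map_homotopic_refl hc₀ hx₀ hê₀ hfx₀ hι hcomp
    (F.leafLoop (loopPath γ hc hp) (continuous_toLeafSpace_loopPath γ hc hp)) hnull
  obtain ⟨C⟩ := exists_closedFence ho hc hp hinj hc₀ hx₀ hhol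
  set τ₀ : ℝ := baseLevel γ c₀ with hτ₀def
  -- the three level radii
  obtain ⟨θ₁, hθ₀, hθhalf, sg, hsg, δ₁, hδ₁, hδ₁ε, Hc⟩ := C.exists_constants
  obtain ⟨δ₂, hδ₂, -, Hk⟩ := C.exists_forall_isCompact_leaf hbi
  obtain ⟨δ₃, hδ₃, -, Hn⟩ := C.exists_forall_homotopic_refl_map hf hnull
  set δ : ℝ := min δ₁ (min δ₂ δ₃) with hδdef
  have hδ : 0 < δ := lt_min hδ₁ (lt_min hδ₂ hδ₃)
  have hδδ₁ : δ ≤ δ₁ := min_le_left _ _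
  have hδδ₂ : δ ≤ δ₂ := (min_le_right _ _).trans (min_le_left _ _)
  have hδδ₃ : δ ≤ δ₃ := (min_le_right _ _).trans (min_le_right _ _)
  have hsub : ∀ {d : ℝ}, δ ≤ d → Ioo (τ₀ - δ) (τ₀ + δ) ⊆ Ioo (τ₀ - d) (τ₀ + d) := fun h ↦
    Ioo_subset_Ioo (by linarith) (by linarith)
  -- the leaves of the band are image-null
  have himn : ∀ τ ∈ Ioo (τ₀ - δ) (τ₀ + δ), ImageNull hf (vert γ c₀ τ) := fun τ hτ ↦ by
    obtain ⟨ha, hb, hA, hB⟩ := Hc τ (hsub hδδ₁ hτ)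
    refine imageNull_vert hbi hf C (hsub (hδδ₁.trans hδ₁ε) hτ) (Hk τ (hsub hδδ₂ hτ)) (Hn τ (hsub hδδ₃ hτ))
      hθ₀ hθhalf ha hb ?_
    have h₁ : (sg * ((c₀ (C.Φ θ₁ τ)).1 - baseCoord γ c₀)) * (sg * ((c₀ (C.Φ (σ θ₁) τ)).1 - baseCoord γ c₀)) < 0 :=
      mul_neg_of_pos_of_neg hA hB
    have h₂ : (sg * ((c₀ (C.Φ θ₁ τ)).1 - baseCoord γ c₀)) * (sg * ((c₀ (C.Φ (σ θ₁) τ)).1 - baseCoord γ c₀)) =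
        (sg * sg) * (((c₀ (C.Φ θ₁ τ)).1 - baseCoord γ c₀) * ((c₀ (C.Φ (σ θ₁) τ)).1 - baseCoord γ c₀)) := by
      ring
    rw [h₂] at h₁
    exact neg_of_mul_neg_right h₁ (mul_self_nonneg sg)
  -- `y₀` is a point of the loop
  obtain ⟨s, hs⟩ : (⟨toLeafSpace y₀, hy₀x⟩ : F.Leaf x) ∈ range γ := by rw [hsurj]; exact mem_univ _
  set θ₀ : I := ⟨Int.fract s, Int.fract_nonneg s, (Int.fract_lt_one s).le⟩ with hθ₀def
  have hy₀eq : loopPath γ hc hp θ₀ = y₀ := by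
    show ofLeafSpace ((γ (Int.fract s) : F.Leaf x) : F.LeafSpace) = y₀
    rw [CircleLoops.apply_fract hp s, hs]
    rfl
  -- the local datum of the fence at `θ₀`
  obtain ⟨U, hU, D, hD⟩ := C.isFenceOn.local_level θ₀ (mem_univ _)
  have hθU : θ₀ ∈ U ∩ univ := ⟨mem_of_mem_nhds hU, mem_univ _⟩
  have hpt : ofLeafSpace (C.Γ θ₀).pt = y₀ :=
    (congrArg ofLeafSpace (congr_fun C.proj_comp θ₀)).trans hy₀eq
  have hy₀src : y₀ ∈ D.box.source := hpt ▸ D.pt_mem_source hθU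
  have hy₀ht : height D.box y₀ = D.ψ τ₀ := hpt ▸ D.height_pt hθU
  -- the good heights near `ψ τ₀`
  have hφ : IsHomeoGermAt D.φ (D.ψ τ₀) := D.isHomeoGermAt_φ hθU
  have hφτ₀ : D.φ (D.ψ τ₀) = τ₀ := D.φ_ψ τ₀ C.baseLevel_mem_Ioo
  have hR₁ : ∀ᶠ r in 𝓝 (D.ψ τ₀), D.φ r ∈ Ioo (τ₀ - δ) (τ₀ + δ) := by
    have ht : Tendsto D.φ (𝓝 (D.ψ τ₀)) (𝓝 τ₀) := by
      have h := hφ.continuousAt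
      rwa [ContinuousAt, hφτ₀] at h
    exact ht.eventually (Ioo_mem_nhds (by linarith) (by linarith))
  obtain ⟨R, hRsub, hRo, hR0⟩ := eventually_nhds_iff.1 (hR₁.and D.ψ_φ)
  -- the neighbourhood of `y₀`
  set N : Set X := D.box.source ∩ D.box ⁻¹' (Prod.snd ⁻¹' R) with hNdef
  have hN : IsOpen N := D.box.isOpen_inter_preimage (hRo.preimage continuous_snd)
  have hy₀N : y₀ ∈ N := ⟨hy₀src, by show height D.box y₀ ∈ R; rw [hy₀ht]; exact hR0⟩
  refine mem_of_superset (hN.mem_nhds hy₀N) fun y hy ↦ ?_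
  obtain ⟨hysrc, hyR⟩ := hy
  obtain ⟨hτI, hψφ⟩ := hRsub (height D.box y) hyR
  have hτε : D.φ (height D.box y) ∈ Ioo (τ₀ - C.ε) (τ₀ + C.ε) := hsub (hδδ₁.trans hδ₁ε) hτI
  obtain ⟨hΦsrc, hΦht⟩ := hD θ₀ hθU _ hτε
  -- `y` and the point of the horizontal over `θ₀` at level `φ (h y)` lie on one plaque
  have hplaque_y : y ∈ plaque D.box (height D.box y) := ⟨hysrc, rfl⟩
  have hplaque_Φ : C.Φ θ₀ (D.φ (height D.box y)) ∈ plaque D.box (height D.box y) :=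
    ⟨hΦsrc, hΦht.trans hψφ⟩
  have hyleaf : y ∈ F.leaf (C.Φ θ₀ (D.φ (height D.box y))) :=
    F.plaque_subset_leaf_of_mem D.box_mem (F.mem_leaf_self _) hplaque_Φ hplaque_y
  have hΦleaf : C.Φ θ₀ (D.φ (height D.box y)) ∈ F.leaf (vert γ c₀ (D.φ (height D.box y))) :=
    C.Φ_mem_leaf hτε θ₀
  have hy' : y ∈ F.leaf (vert γ c₀ (D.φ (height D.box y))) := by
    rw [← F.leaf_eq_of_mem hΦleaf]
    exact hyleaf
  exact (himn _ hτI).of_mem_leaf hy'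

end Band

end Literature.Topology.PlanarFoliations
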